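import Summits.CriticalPhenomena.PercolationContinuityZ3.Theorems.Transplant.SkelFrm1ReachHoldsQ3V
import Summits.CriticalPhenomena.PercolationContinuityZ3.Theorems.Transplant.SkelFrmBChoiceResidQV
import HarnessLib

/-!
# N2 (frames-only node `SamePDropOfSkeletonFrm₁`, OPEN), (C) column, THE TARGET OF RECORD (step 2, thin instance at the node tuple):
# `PlanarSkeletonFrm.reachHoldsRHNQFnLK_frmChoiceAllQ3V`

The (C) column Prop of the node theorem AT THE NODE TUPLE OF RECORD (V letters; lead g12 11:46:03Z / 13:40Z (1), stmt-g21 12:50:55Z), PARAMETRIC IN THE K-FLOOR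
(shape of record, lead g14 J27 ruling 2026-08-23T22:22:18Z: the column's own certified floor `160 ≤ Kmin` is the only hypothesis; node₂ instantiates `Kmin := 480`):
`ReachHoldsRHNQFnLK NegB.LfQ Kmin (frmChoiceAllQ3V (KS.gT 0 (gxQ 0 gxR fxR)) (KS.fT 0 (fxQ 0 fxR)) (KS.PR 0 (PxQ 0 PxR)) (SUS (exQ 0 exR) (mxQ mxR)) (cR2W 0) (hFR 0) BSlot.small3)`
for EVERY `Kmin ≥ 160` and EVERY choice of the (R) column's residual slot functions `gxR fxR exR mxR PxR` (the tuple is parametric in them — stmt's union file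
SkelFrmBChoiceResidQV; node₂ instantiates them at p3's `SkelFrmBChoiceResidR` values and `mxR := NegB.mxF 0`) — ONE application of the slot-robust form
`reachHoldsRHNQFnLK_frmChoiceAllQ3V_of_le Kmin hKmin 0` (SkelFrm1ReachHoldsQ3V) to stmt's three domination lemmas `NegB.Hg_Q` (box slot: `gFloorKG ≤ gT ∧ 40·K·R'0 ≤ gT`),
`NegB.Hex_Q` (`r₀0 + 3 ≤ exQ ∧ ZD2 + 4 ≤ exQ`), `NegB.HexY_Q` (`… ∧ ZDYW + 4 ≤ exQ`).  NON-VACUITY (lead g11 standing order): no geometry row is introduced here; the residual unions are free slots (ResidQV's note).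
builds on p205010 (kernel theorem, internal audit signed; external expert review pending) — nothing in this file uses p205010; NOTHING here is a claim about the open
node `SamePDropOfSkeletonFrm₁` (this is one of the four column Props its closure `samePDropOfSkeletonFrm₁_of_choiceFnNQLTK` takes; p3's node₂ file applies it).
Lane `prim-bschramm`, seat `prim-bschramm-p5` (gen 17; (C) column); helper file (`--supports stmt-CriticalPhenomena-4575 --as helper`).
[cite: KozmaNitzan2024, §4 Lemma 12 (pp. 23–25), p. 30 (Step IV)] [cite: MartineauTassion2017, §4.3 Lemma 4.2]
-/

open scoped Classical

noncomputable section

namespace Summit.CriticalPhenomena.PercolationContinuityZ3.Theorems.Transplant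

namespace PlanarSkeletonFrm

open Literature.Probability.Percolation Literature.Probability.LatticeModels SimpleGraph
open SkelConc (Consts)

/-- **THE (C) COLUMN TARGET OF RECORD AT THE NODE TUPLE** (K-floor `Kmin ≥ 160` as a parameter — node₂ takes `Kmin := 480` (J27); kit index `mk := 0`, window
`BSlot.small3 = (76·s₀, 19·s₁)`, creep `cR2W 0`, forward room `hFR 0`), parametric in the (R) column's residual slot functions.
[cite: KozmaNitzan2024, §4 Lemma 12 (pp. 23–25), p. 30 (Step IV)] -/
theorem reachHoldsRHNQFnLK_frmChoiceAllQ3V (Kmin : ℕ) (hKmin : 160 ≤ Kmin) (gxR fxR : Neg.FSlot) (exR mxR : NegB.GSlot) (PxR : NegB.PSlot) :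
    ReachHoldsRHNQFnLK NegB.LfQ Kmin
      (frmChoiceAllQ3V (NegB.KS.gT 0 (NegB.gxQ 0 gxR fxR)) (NegB.KS.fT 0 (NegB.fxQ 0 fxR)) (NegB.KS.PR 0 (NegB.PxQ 0 PxR))
        (NegB.SUS (NegB.exQ 0 exR) (NegB.mxQ mxR)) (NegB.cR2W 0) (NegB.hFR 0) NegB.BSlot.small3) :=
  reachHoldsRHNQFnLK_frmChoiceAllQ3V_of_le Kmin hKmin 0
    (fun _ _ _ _ _ _ _ _ _ D => NegB.Hg_Q 0 gxR fxR D)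
    (fun _ _ _ _ _ _ _ _ _ D g f => NegB.Hex_Q 0 exR D g f)
    (fun _ _ _ _ _ _ _ _ _ D g f => NegB.HexY_Q 0 exR D g f)

end PlanarSkeletonFrm

end Summit.CriticalPhenomena.PercolationContinuityZ3.Theorems.Transplant

end
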